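import Mathlib
import HarnessLib
import Literature.Combinatorics.Additive.QuasiProgressions

/-!
# Grynkiewicz 2009, Theorem 4.1: the periodic case and the first reductions of §6 (Claims 1–2)

[cite: Grynkiewicz2009, Thm 4.1 (second part); §6 Claims 1–2] [tag: critical-pair] [tag: inverse-theorem]

Topic `Literature/Combinatorics/Additive`.  Cell `mm-stpp` (D-0046), seat `mm-stpp-lit` (gen 23); the
port of D. J. Grynkiewicz, *A step beyond Kemperman's structure theorem*, Mathematika **55** (2009)
67–114 continued — the opening of §6 «The Main Proof» (the proof of Theorem 4.1, print pp. 23–36):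
«We may assume w.l.o.g. that `0 ∈ A ∩ B`. If either `A` or `B` is extendible, then (17) immediately
follows … **Claim 1:** `d⊆(A + B, 𝒫) ≥ 1`, else the proof is complete» — which is the second part of
Theorem 4.1: «If `A + B` is periodic with maximal period `H_a`, then either (17) holds, or else `A` and
`B` are `H_a`-periodic, `φ_a(A + B)` is aperiodic, and `|φ_a(A) + φ_a(B)| = |φ_a(A)| + |φ_a(B)|» —
and «**Claim 2:** `d⊆(A + B, 𝒫) ≥ 2`» (otherwise (17) holds).

SOURCE (print p. 23 L36 – p. 24 L11 of the held text `paper:doi-10-1112-s0025579300000966`;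
arXiv:0710.1041v2 pp. 21–22; read 2026-08-29).  Statement of Theorem 4.1 (second part): print p. 10.

MAIN RESULTS (0 definitions, 0 named facts; everything PROVED; any abelian group `G`).
* `Grynkiewicz2009.seventeen_of_insert_add_eq` (and `seventeen_of_add_insert_eq`) — «If either `A` or
  `B` is extendible, then (17) immediately follows».
* `Grynkiewicz2009.seventeen_or_isPeriodicWith_of_addStab` — **Theorem 4.1, second part** (= Claim 1):
  `|A + B| = |A| + |B|`, `H = H(A + B)` ⟹ (17), or `A + H = A`, `B + H = B`, the image of `A + B` in
  `G ⧸ H` is aperiodic and `|φ_H(A + B)| = |φ_H(A)| + |φ_H(B)|` (stated for the stabilizer finset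
  `(A + B).addStab` of the tree's `Kneser.lean`; true — vacuously for the last three clauses' content —
  also when `H(A + B) = 0`, so the hypothesis «`A + B` periodic» is not carried).
* `Grynkiewicz2009.seventeen_of_addStab_insert_ne` — **Claim 2**: if `(A + B) ∪ {γ}` (`γ ∉ A + B`) is
  periodic then (17) holds, with `α ∈ (γ − B) ∩ (H + A)`, `β ∈ (γ − A) ∩ (H + B)`.

PROOF NOTES.  Claim 1 as printed: if `A` is not `H`-periodic there is `α ∈ (A + H) ∖ A` with
`(A ∪ {α}) + B = A + B` («contradicting that `A` is non-extendible» — here it yields (17) directly by the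
preceding remark), and when both are `H`-periodic the three displayed alternatives for `|φ_H(A + B)|`
collapse, `|X| = |H| |φ_H(X)|` for `H`-periodic `X` (`card_addStab_add_card_image_coe'`,
`card_add_card_eq_addStab_card_add_coe` of `Kneser.lean`), to `|φ_H(A + B)| = |φ_H(A)| + |φ_H(B)|`;
`φ_H(A + B)` aperiodic is `addStab_image_coe_quotient`.  Claim 2 verbatim.

## References
* D. J. Grynkiewicz, *A step beyond Kemperman's structure theorem*, Mathematika 55 (2009) 67–114,
  doi:10.1112/S0025579300000966, Theorem 4.1 (p. 10) and §6, Claims 1–2 (pp. 23–24);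
  arXiv:0710.1041v2 [cite: Grynkiewicz2009, Thm 4.1] — held `paper:doi-10-1112-s0025579300000966` /
  `paper:arxiv-0710.1041`.
-/

namespace Literature.Combinatorics.Additive

open Finset
open scoped Pointwise

universe u

namespace Grynkiewicz2009

variable {G : Type u} [AddCommGroup G] [DecidableEq G]

/-! ### «If either `A` or `B` is extendible, then (17) immediately follows» -/

/-- If `A` is extendible with respect to `B` — `(A ∪ {a}) + B = A + B` for some `a ∉ A` — and
`|A + B| = |A| + |B|`, then (17) holds (with `α = a` and `β ∈ B`). [cite: Grynkiewicz2009, §6 (proof of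
Thm 4.1, «If either A or B is extendible, then (17) immediately follows»)] -/
theorem seventeen_of_insert_add_eq {A B : Finset G} {a : G} (ha : a ∉ A)
    (heq : insert a A + B = A + B) (hB : B.Nonempty) (hAB : #(A + B) = #A + #B) :
    ∃ α β : G, #(insert α A + insert β B) + 1 = #(insert α A) + #(insert β B) := by
  obtain ⟨b, hb⟩ := hB
  refine ⟨a, b, ?_⟩
  rw [insert_eq_of_mem hb, heq, card_insert_of_notMem ha, hAB]
  omega

/-- The same with the roles of `A` and `B` exchanged: `A + (B ∪ {b}) = A + B`, `b ∉ B`, gives (17).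
[cite: Grynkiewicz2009, §6 (proof of Thm 4.1, «If either A or B is extendible, then (17) immediately
follows»)] -/
theorem seventeen_of_add_insert_eq {A B : Finset G} {b : G} (hb : b ∉ B)
    (heq : A + insert b B = A + B) (hA : A.Nonempty) (hAB : #(A + B) = #A + #B) :
    ∃ α β : G, #(insert α A + insert β B) + 1 = #(insert α A) + #(insert β B) := by
  obtain ⟨a, ha⟩ := hA
  refine ⟨a, b, ?_⟩
  rw [insert_eq_of_mem ha, heq, card_insert_of_notMem hb, hAB]
  omega

/-! ### Theorem 4.1, second part (Claim 1): `A + B` periodic -/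

/-- If `A` is not `H(A + B)`-periodic then (17) holds: some `α ∈ (A + H) ∖ A` has
`(A ∪ {α}) + B ⊆ A + B + H = A + B` («If `A` and `B` are not both `H`-periodic, then w.l.o.g. there
exists `α ∈ Ā` such that `φ_H(A) = φ_H(A ∪ {α})`. Hence, since `A + B` is `H`-periodic, it follows that
`(A ∪ {α}) + B = A + B`»). [cite: Grynkiewicz2009, §6 Claim 1 (proof of Thm 4.1)] -/
theorem seventeen_of_add_addStab_ne {A B : Finset G} (hA : A.Nonempty) (hB : B.Nonempty)
    (hAB : #(A + B) = #A + #B) (hAS : A + (A + B).addStab ≠ A) :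
    ∃ α β : G, #(insert α A + insert β B) + 1 = #(insert α A) + #(insert β B) := by
  have h0S : (0 : G) ∈ (A + B).addStab := (hA.add hB).zero_mem_addStab
  have hsub : A ⊆ A + (A + B).addStab := subset_add_left A h0S
  obtain ⟨α, hα, hαA⟩ := exists_of_ssubset (hsub.ssubset_of_ne (Ne.symm hAS))
  refine seventeen_of_insert_add_eq hαA (Subset.antisymm ?_ ?_) hB hAB
  · calc insert α A + B ⊆ A + (A + B).addStab + B := add_subset_add_right (insert_subset hα hsub)
      _ = A + B := by rw [add_right_comm, add_addStab]
  · exact add_subset_add_right (subset_insert α A)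

/-- **Grynkiewicz 2009, Theorem 4.1, second part** (= §6, Claim 1).  «If `A + B` is periodic with
maximal period `H_a`, then either (17) holds, or else `A` and `B` are `H_a`-periodic, `φ_a(A + B)` is
aperiodic, and `|φ_a(A) + φ_a(B)| = |φ_a(A)| + |φ_a(B)|» — for finite nonempty `A, B` with
`|A + B| = |A| + |B|` in an abelian group; `H_a = H(A + B)` is the stabilizer finset `(A + B).addStab`,
`φ_a` the quotient map `G → G ⧸ H(A + B)` (images as finsets; `φ_a(A) + φ_a(B) = φ_a(A + B)`), (17) as
in the ports of §5.  The hypothesis that `A + B` be periodic is not needed for the dichotomy as stated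
(when `H(A + B) = 0` the second alternative holds trivially) and is dropped.  PROOF as printed (p. 23):
`seventeen_of_add_addStab_ne` twice; for `H`-periodic `A`, `B` the count «`|A + B| = |H| |φ_H(A + B)|`,
`|H + A| = |A|`, `|H + B| = |B|`» makes `|φ_H(A + B)| = |φ_H(A)| + |φ_H(B)|` the only one of the three
printed alternatives compatible with `|A + B| = |A| + |B|`. [cite: Grynkiewicz2009, Thm 4.1 (second
part); §6 Claim 1] -/
theorem seventeen_or_isPeriodicWith_of_addStab {A B : Finset G} (hA : A.Nonempty) (hB : B.Nonempty)
    (hAB : #(A + B) = #A + #B) :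
    (∃ α β : G, #(insert α A + insert β B) + 1 = #(insert α A) + #(insert β B)) ∨
      (A + (A + B).addStab = A ∧ B + (A + B).addStab = B ∧
        ((A + B).image (QuotientAddGroup.mk : G → G ⧸ AddAction.stabilizer G ((A + B : Finset G) : Set G))).addStab = {0} ∧
        #((A + B).image (QuotientAddGroup.mk : G → G ⧸ AddAction.stabilizer G ((A + B : Finset G) : Set G))) =
          #(A.image (QuotientAddGroup.mk : G → G ⧸ AddAction.stabilizer G ((A + B : Finset G) : Set G))) +
          #(B.image (QuotientAddGroup.mk : G → G ⧸ AddAction.stabilizer G ((A + B : Finset G) : Set G)))) := by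
  by_cases hAS : A + (A + B).addStab = A
  swap
  · exact Or.inl (seventeen_of_add_addStab_ne hA hB hAB hAS)
  by_cases hBS : B + (A + B).addStab = B
  swap
  · left
    have hBA : #(B + A) = #B + #A := by rw [add_comm, hAB, add_comm]
    obtain ⟨β, α, h⟩ := seventeen_of_add_addStab_ne hB hA hBA (by rwa [add_comm B A])
    exact ⟨α, β, by rw [add_comm (insert α A), h, add_comm]⟩
  right
  have hABne : (A + B).Nonempty := hA.add hB
  refine ⟨hAS, hBS, ?_, ?_⟩
  · rw [Finset.singleton_zero]
    exact addStab_image_coe_quotient hABne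
  · have h1 := card_add_card_eq_addStab_card_add_coe A B
    have h2 := card_addStab_add_card_image_coe' A (A + B)
    have h3 := card_addStab_add_card_image_coe' B (A + B)
    rw [hAS] at h2
    rw [hBS] at h3
    have hpos : 0 < #(A + B).addStab := card_pos.2 hABne.addStab
    apply Nat.eq_of_mul_eq_mul_left hpos
    rw [← h1, mul_add, h2, h3, hAB]

/-! ### Claim 2: `(A + B) ∪ {γ}` periodic gives (17) -/

/-- **§6, Claim 2** («`d⊆(A + B, 𝒫) ≥ 2`»): if `|A + B| = |A| + |B|` and `(A + B) ∪ {γ}` is periodic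
for some `γ ∉ A + B` (maximal period `H`), then (17) holds: «Note `φ_H(γ) ∈ φ_H(A + B)`. Hence choosing
`α ∈ (γ − B) ∩ (H + A)` and `β ∈ (γ − A) ∩ (H + B)`, it follows that
`(A ∪ {α}) + (B ∪ {β}) = (A + B) ∪ {γ}`, whence (17) holds.»  (With `0 ≠ h ∈ H`, `γ + h = a + b`,
`α = a − h`, `β = b − h`.) [cite: Grynkiewicz2009, §6 Claim 2 (proof of Thm 4.1)] -/
theorem seventeen_of_addStab_insert_ne {A B : Finset G} {γ : G} (hγ : γ ∉ A + B)
    (hAB : #(A + B) = #A + #B) (hper : (insert γ (A + B)).addStab ≠ {0}) :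
    ∃ α β : G, #(insert α A + insert β B) + 1 = #(insert α A) + #(insert β B) := by
  set P := insert γ (A + B) with hPdef
  have hPne : P.Nonempty := ⟨γ, mem_insert_self γ _⟩
  -- a nonzero period `h`
  obtain ⟨h, hhS, hh0⟩ : ∃ h ∈ P.addStab, h ≠ (0 : G) := by
    by_contra hno
    push Not at hno
    apply hper
    exact Subset.antisymm (fun x hx => mem_singleton.2 (hno x hx))
      (singleton_subset_iff.2 hPne.zero_mem_addStab)
  have hhP : h +ᵥ P = P := (mem_addStab hPne).1 hhS
  have hplus : ∀ x ∈ P, h + x ∈ P := fun x hx => by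
    have := vadd_mem_vadd_finset (a := h) hx
    rwa [hhP, vadd_eq_add] at this
  have hminus : ∀ x ∈ P, x - h ∈ P := fun x hx => by
    rw [← hhP] at hx
    obtain ⟨y, hy, hyx⟩ := mem_vadd_finset.1 hx
    rw [← hyx, vadd_eq_add, add_sub_cancel_left]
    exact hy
  -- `γ + h ∈ A + B`
  have hγh : h + γ ∈ A + B := by
    have := hplus γ (mem_insert_self γ _)
    rw [hPdef, mem_insert] at this
    rcases this with heq | hmem
    · exact absurd (add_eq_right.1 heq) hh0
    · exact hmem
  obtain ⟨a, ha, b, hb, hab⟩ := mem_add.1 hγh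
  have hAPB : A + B ⊆ P := subset_insert γ _
  -- `α = a − h`, `β = b − h`
  have hαA : a - h ∉ A := fun hmem => hγ (by
    have : a - h + b = γ := by rw [sub_add_eq_add_sub, hab, add_sub_cancel_left]
    rw [← this]; exact add_mem_add hmem hb)
  have hβB : b - h ∉ B := fun hmem => hγ (by
    have : a + (b - h) = γ := by rw [← add_sub_assoc, hab, add_sub_cancel_left]
    rw [← this]; exact add_mem_add ha hmem)
  have heq : insert (a - h) A + insert (b - h) B = P := by
    refine Subset.antisymm (add_subset_iff.2 fun x hx y hy => ?_) (insert_subset ?_ ?_)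
    · rw [mem_insert] at hx hy
      rcases hx with rfl | hx <;> rcases hy with rfl | hy
      · have : a - h + (b - h) = γ - h := by
          rw [show a - h + (b - h) = (a + b) - h - h by abel, hab, add_sub_cancel_left]
        rw [this]; exact hminus γ (mem_insert_self γ _)
      · have : a - h + y = (a + y) - h := by abel
        rw [this]; exact hminus _ (hAPB (add_mem_add ha hy))
      · have : x + (b - h) = (x + b) - h := by abel
        rw [this]; exact hminus _ (hAPB (add_mem_add hx hb))
      · exact hAPB (add_mem_add hx hy)
    · have : a - h + b = γ := by rw [sub_add_eq_add_sub, hab, add_sub_cancel_left]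
      rw [← this]
      exact add_mem_add (mem_insert_self _ _) (mem_insert_of_mem hb)
    · exact add_subset_add (subset_insert _ _) (subset_insert _ _)
  refine ⟨a - h, b - h, ?_⟩
  rw [heq, hPdef, card_insert_of_notMem hγ, card_insert_of_notMem hαA, card_insert_of_notMem hβB,
    hAB]
  omega

end Grynkiewicz2009

end Literature.Combinatorics.Additive
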